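/-
Copyright (c) 2026 the pub-hodgecm-mathlib formalisation cell (harness21).  Prover seat hodgecm-mathlib-K2E3-p05 (g2), Track B «K2-LIT», engine E3, unit U4 «Keys»,
2026-09-04.  KERNEL module: THEOREMS ONLY (no definition, no named fact, no `sorry`, no instance, no notation).
-/
import Summits.HodgeConjecture.HodgeConjecture.Theorems.K2E3IwahoriDetection      -- ★-filed p856366 (this seat): `exists_iwahoriDatum_K_zero_eq`, §1; brings ★ N1, ★ Jacquet, ★ JacquetRankStrictMono, the (G3) letters
import HarnessLib

/-!
# K2 ∕ E3 «EllipticInputs», unit U4 «Keys» — Road II of MEMO `hK-KeysThmTwo`, stub II-3′ «IWAHORI CODETECTION»: a PROPER `G`-stable subspace of a REGULAR UNRAMIFIED principal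
# series `i_G(χ)` of `U(Φ₃)(L⁺_v)` (`v` inert) does NOT contain the Iwahori plane `i_G(χ)^I`  [Borel1976 §4 Lemma 4.7; Casselman1995 Thm. 3.3.3, Prop. 2.2.4, L. 7.1.1]

Cell hodgecm-mathlib (D-0151), FLOOR 0, Track B «K2-LIT», engine E3, crux item H413 = stmt-HodgeConjecture-24833 (route `HCCMUnconditional`, no route verbs); target BY NAME
`…K2E3EllipticInputs.U4Keys.sig_K2E3KeysThmTwoContracting` (U4-f), unramified first rung (Road II): with ★-filed II-3 (`0 ≠ u ∈ N ∩ V^I`) THIS FILE makes `N ∩ V^I` a LINE of the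
Iwahori plane (not the whole plane), which is the hypothesis `hline` of ★ p855172 `criterion_of_iwahoriLine`.  Author K2E3-p05 (g2).  `--supports stmt-HodgeConjecture-24833 --as helper`.

THE MATHEMATICS (Borel's lemma, the quotient direction, via regularity).  `V = i_G(χ)`, `χ = (χ₁, χ₂)` continuous, REGULAR (`χ ≠ wχ`) and UNRAMIFIED together with `wχ` (both
trivial on `T ∩ K_v`).  ★ N1: `r_B V` is a plane with a line `ℓ` on which `T` acts by `wχ` and modulo which by `χ` (normalised).  (1) LINEAR ALGEBRA (§1): for `m₁ ∈ T ∩ I` the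
operator `J₁ = r(m₁)` is `1` on `ℓ` and `J₁ − 1` maps into `ℓ`; pick `m₀` with `a := wχ(m₀) ≠ χ(m₀) =: b` and `J₀ = r(m₀)`: `J₀ = a` on `ℓ`, `J₀ − b` maps into `ℓ`, `J₀J₁ = J₁J₀` (`T` abelian).
Then `(J₀ − a)(J₀ − b) = 0`, `x = (a − b)⁻¹((J₀ − b)x − (J₀ − a)x)`, `J₁` fixes `(J₀ − b)x ∈ ℓ`, and `J₁q − q = (J₀ − a)(J₁x − x) = 0` for `q = (J₀ − a)x`: so `J₁ = 1` on `r_B V`.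
(2) `δ_B^{1∕2} = 1` on `I`, so `T ∩ I` acts trivially on the UNNORMALISED Jacquet module: `(r_B V)^{T ∩ I} = r_B V`.  (3) JACQUET'S LEMMA at the level `I` (★ over ★-filed
`exists_iwahoriDatum_K_zero_eq`): `V^I ↠ r_B V`, i.e. the image of `V^I` in `r_B V` is everything (dimension `2`).  (4) If `V^I ⊆ N` with `N ≠ ⊤` then the image of `N` in `r_B V`
would have dimension `≥ 2`, against STRICT MONOTONICITY ★ `finrank_map_coinvariantsMk_lt_of_lt` (`N < ⊤ ⇒ dim < dim image of ⊤ ≤ 2`).  Hence **`V^I ⊄ N`**.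
§1 `apply_eq_self_of_line_data` (linear algebra) · §2 (abstract) `normalizedJacquet_apply_eq_self_of_lineDatum`, `jacquetModule_apply_eq_self_of_normalizedJacquet_eq_self`,
`not_fixedPoints_le_of_jacquet_trivial` · §3 `not_fixedPoints_I_le` (the codetection).
HONEST LABEL: HC_CM is proved only modulo the 7 printed citations (2 remaining named inputs: hLiu418 = stmt-HodgeConjecture-24832, h413 = stmt-HodgeConjecture-24833)
until rung 0 closes; count-neutral (a classical lemma made available in house; the assembly II-4 is the sequel).

## References
* [Borel1976] A. Borel, Invent. Math. 35 (1976), §3–§4, Lemma 4.7.  * [Casselman1995] W. Casselman, notes (1995), Prop. 2.2.4, Thm. 3.3.3, L. 7.1.1, Prop. 7.1.3.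
* [BernsteinZelevinsky1977] Ann. Sci. ÉNS 10 (1977), §2.3, Thm. 2.9.  * [Keys1984] D. Keys, Compositio Math. 51 (1984), §3, §7.
-/

set_option autoImplicit false
-- the mandated namespace has the single-problem summit's repeated segment (`HodgeConjecture.HodgeConjecture`)
set_option linter.dupNamespace false

noncomputable section

open NumberField IsDedekindDomain MeasureTheory
open scoped Matrix MatrixGroups NNReal WithZero
open Literature.NumberTheory Literature.NumberTheory.Automorphic Literature.NumberTheory.Automorphic.UnitaryGroup
open Literature.NumberTheory.Rogawski1990 Literature.NumberTheory.GaloisRepresentations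
open Literature.RepresentationTheory.FiniteGroups Literature.RepresentationTheory.Semisimple

namespace Summit.HodgeConjecture.HodgeConjecture.Cruxes.H413.K2E3IwahoriCodetection

open Summit.HodgeConjecture.HodgeConjecture.Cruxes.H413
open Summit.HodgeConjecture.HodgeConjecture.Cruxes.H413.F0P3cStCharTSStLevelsTransport
open Summit.HodgeConjecture.HodgeConjecture.Cruxes.H413.K2E3IwahoriDetection
open Summit.HodgeConjecture.HodgeConjecture.Cruxes.H413.K2E3PSRegularReducibleCompZero
open F0P2pCmPrincipalSeriesInterface

universe u

/-! ## §1 Linear algebra: a commuting operator that is `1` on the line and `1` modulo the line, against a regular one, is `1` -/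

/-- **`J₁ = 1`** on a module carrying a line `ℓ` and commuting operators `J₀, J₁` with `J₀ = a` on `ℓ`, `J₀ ≡ b (mod ℓ)`, `a ≠ b`, `J₁ = 1` on `ℓ`, `J₁ ≡ 1 (mod ℓ)`: decompose
`x = (a − b)⁻¹((J₀ − b)x − (J₀ − a)x)`; `J₁` fixes the first summand (in `ℓ`) and the second (`J₁q − q = (J₀ − a)(J₁x − x) ∈ (J₀ − a)ℓ = 0`). [folklore] [cite: Keys1984, §3] -/
theorem apply_eq_self_of_line_data {C : Type*} [AddCommGroup C] [Module ℂ C] (ℓ : Submodule ℂ C) (J₀ J₁ : C →ₗ[ℂ] C) (a b : ℂ) (hab : a ≠ b)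
    (hJ₀ℓ : ∀ x ∈ ℓ, J₀ x = a • x) (hJ₀q : ∀ x, J₀ x - b • x ∈ ℓ) (hJ₁ℓ : ∀ x ∈ ℓ, J₁ x = x) (hJ₁q : ∀ x, J₁ x - x ∈ ℓ)
    (hcomm : ∀ x, J₀ (J₁ x) = J₁ (J₀ x)) (x : C) : J₁ x = x := by
  -- `(J₀ − a)` kills `ℓ`
  have hkill : ∀ y ∈ ℓ, J₀ y - a • y = 0 := fun y hy => by rw [hJ₀ℓ y hy, sub_self]
  -- the two summands
  set p : C := J₀ x - b • x with hp
  set q : C := J₀ x - a • x with hq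
  have hpℓ : p ∈ ℓ := hJ₀q x
  have hx : x = (a - b)⁻¹ • (p - q) := by
    have hab' : a - b ≠ 0 := sub_ne_zero.2 hab
    rw [hp, hq]
    have : J₀ x - b • x - (J₀ x - a • x) = (a - b) • x := by rw [sub_smul]; abel
    rw [this, smul_smul, inv_mul_cancel₀ hab', one_smul]
  -- `J₁ p = p`, `J₁ q = q`
  have hJp : J₁ p = p := hJ₁ℓ p hpℓ
  have hJq : J₁ q = q := by
    have h1 : J₁ q - q = J₀ (J₁ x - x) - a • (J₁ x - x) := by
      rw [hq, map_sub, map_smul, map_sub, smul_sub, ← hcomm]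
      abel
    have h2 : J₀ (J₁ x - x) - a • (J₁ x - x) = 0 := hkill _ (hJ₁q x)
    rw [h2] at h1
    exact sub_eq_zero.1 h1
  calc J₁ x = J₁ ((a - b)⁻¹ • (p - q)) := by rw [← hx]
    _ = (a - b)⁻¹ • (p - q) := by rw [map_smul, map_sub, hJp, hJq]
    _ = x := hx.symm

/-! ## §2 Abstract: from a regular line datum to the triviality of `M ∩ K` on `r_P π`, and the codetection -/

section Abstract

variable {G : Type u} [Group G] [TopologicalSpace G] [IsTopologicalGroup G] (t : ParabolicTriple G)

/-- **`M ∩ K` fixes the normalised Jacquet module**, abstract form: given the filtration datum «a line `ℓ ⊆ r_P π` on which `M` acts by `wχ` and modulo which by `χ`» (the shape of ★ N1's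
third conjunct), an element `m₀ ∈ M` with `wχ(m₀) ≠ χ(m₀)`, and `m₁ ∈ M` commuting with `m₀` with `χ(m₁) = wχ(m₁) = 1`: `r(m₁) = 1` on `r_P π` (§1). [cite: Casselman1995, L. 7.1.1] [cite: Keys1984, §3] -/
theorem normalizedJacquet_apply_eq_self_of_lineDatum [LocallyCompactSpace ↥t.P] {V : Type*} [AddCommGroup V] [Module ℂ V]
    (π : Representation ℂ G V) (χ wχ : ↥t.M →* ℂˣ)
    (hJ : ∃ ℓ : Submodule ℂ (t.restrict π).Coinvariants, Module.finrank ℂ ↥ℓ = 1 ∧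
      (∀ (m : ↥t.M), ∀ x ∈ ℓ, π.normalizedJacquet t m x = ((wχ m : ℂˣ) : ℂ) • x) ∧
      (∀ (m : ↥t.M) (x : (t.restrict π).Coinvariants), π.normalizedJacquet t m x - ((χ m : ℂˣ) : ℂ) • x ∈ ℓ))
    (m₀ : ↥t.M) (hm₀ : ((wχ m₀ : ℂˣ) : ℂ) ≠ ((χ m₀ : ℂˣ) : ℂ)) (m₁ : ↥t.M) (hχ : χ m₁ = 1) (hwχ : wχ m₁ = 1) (hcomm : m₀ * m₁ = m₁ * m₀)
    (x : (t.restrict π).Coinvariants) : π.normalizedJacquet t m₁ x = x := by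
  obtain ⟨ℓ, -, hline, hq⟩ := hJ
  refine apply_eq_self_of_line_data ℓ (π.normalizedJacquet t m₀) (π.normalizedJacquet t m₁) _ _ hm₀ (hline m₀) (hq m₀)
    (fun y hy => by rw [hline m₁ y hy, hwχ, Units.val_one, one_smul]) (fun y => by simpa [hχ] using hq m₁ y) (fun y => ?_) x
  change (π.normalizedJacquet t m₀ * π.normalizedJacquet t m₁) y = (π.normalizedJacquet t m₁ * π.normalizedJacquet t m₀) y
  rw [← map_mul, ← map_mul, hcomm]

/-- **From the normalised to the unnormalised Jacquet module on `M ∩ K`**: if `r^{norm}(m) = 1` and `δ_P^{1∕2}(m) = 1` for `m ∈ M ∩ K` then `r(m) = 1` (`r^{norm} = r ⊗ δ^{-1∕2}`,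
★ `Representation.twist_apply`). [cite: Casselman1995, §3.1] -/
theorem jacquetModule_apply_eq_self_of_normalizedJacquet_eq_self [LocallyCompactSpace ↥t.P] {V : Type*} [AddCommGroup V] [Module ℂ V]
    (π : Representation ℂ G V) (K : Subgroup G)
    (hJ : ∀ m : ↥t.M, (m : G) ∈ K → ∀ x : (t.restrict π).Coinvariants, π.normalizedJacquet t m x = x)
    (hδ : ∀ m : ↥t.M, (m : G) ∈ K → rootDeltaChar t.P (Subgroup.inclusion t.M_le m) = 1) :
    ∀ m : ↥t.M, (m : G) ∈ K → ∀ x : (t.restrict π).Coinvariants, π.jacquetModule t m x = x := by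
  intro m hm x
  have e : π.normalizedJacquet t m x = ((((rootDeltaChar t.P)⁻¹.comp (Subgroup.inclusion t.M_le)) m : ℂˣ) : ℂ) • π.jacquetModule t m x :=
    Representation.twist_apply _ _ _ _
  rw [hJ m hm x, MonoidHom.comp_apply, MonoidHom.inv_apply, hδ m hm, inv_one, Units.val_one, one_smul] at e
  exact e.symm

/-- **CODETECTION, abstract form.**  `π` admissible and smooth, `N` a union of compact open subgroups, every constituent of `π` with non-zero Jacquet module, `r_P π` finite-dimensional; if
`M ∩ K₀` (`K₀ = 𝓘.K 0`) acts trivially on the unnormalised `r_P π`, then NO proper `G`-stable `N′ ≠ ⊤` contains `π^{K₀}`: Jacquet's lemma (★ `fixedPoints_jacquetModule_le_map`) makes the image of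
`π^{K₀}` all of `r_P π`, while the image of `N′ < ⊤` is a proper subspace (★ `finrank_map_coinvariantsMk_lt_of_lt`). [cite: Casselman1995, Thm. 3.3.3, Prop. 3.2.3] [cite: Borel1976, Lemma 4.7] -/
theorem not_fixedPoints_le_of_jacquet_trivial (𝓘 : t.IwahoriDatum) {V : Type} [AddCommGroup V] [Module ℂ V]
    (π : Representation ℂ G V) (hadm : π.IsAdmissible) (hsm : π.IsSmooth) (hN : IsLimitOfCompactOpen ↥t.N)
    (hJH : ∀ c : IrrClass G, c.IsConstituentOf π → ∃ r : SmoothIrrep G, IrrClass.mk r = c ∧ Nontrivial (t.restrict r.ρ).Coinvariants)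
    [FiniteDimensional ℂ (t.restrict π).Coinvariants]
    (hfix : ∀ m : ↥t.M, (m : G) ∈ 𝓘.K 0 → ∀ x : (t.restrict π).Coinvariants, π.jacquetModule t m x = x)
    (N : Subrepresentation π) (htop : N ≠ ⊤) : ¬ (π.fixedPoints (𝓘.K 0) ≤ N.toSubmodule) := by
  intro hle
  -- Jacquet's lemma at level `K₀`: every class is the image of a `K₀`-fixed vector, hence of a vector of `N`
  have htopfix : ∀ ξ : (t.restrict π).Coinvariants, ξ ∈ N.toSubmodule.map (Representation.Coinvariants.mk (t.restrict π)) := by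
    intro ξ
    have hξfix : ξ ∈ (π.jacquetModule t).fixedPoints ((𝓘.K 0).comap t.M.subtype) :=
      (Representation.mem_fixedPoints _ _ _).2 fun m hm => hfix m (Subgroup.mem_comap.1 hm) ξ
    obtain ⟨y, hy, hyξ⟩ := JacquetLemma.fixedPoints_jacquetModule_le_map π t 𝓘 hadm 0 hξfix
    exact ⟨y, hle hy, hyξ⟩
  -- strict monotonicity: the image of `N < ⊤` is a proper subspace of the image of `⊤`
  have hNlt : N < ⊤ := lt_top_iff_ne_top.2 htop
  have hlt := Representation.finrank_map_coinvariantsMk_lt_of_lt t hN hsm hJH hNlt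
  have htopN : N.toSubmodule.map (Representation.Coinvariants.mk (t.restrict π)) = ⊤ := Submodule.eq_top_iff'.2 htopfix
  have hle' : (⊤ : Subrepresentation π).toSubmodule.map (Representation.Coinvariants.mk (t.restrict π)) ≤
      N.toSubmodule.map (Representation.Coinvariants.mk (t.restrict π)) := by
    rw [htopN]; exact le_top
  exact absurd (Submodule.finrank_mono hle') (not_le.2 hlt)

end Abstract

/-! ## §3 The CM head: codetection for the regular unramified principal series of `U(Φ₃)(L⁺_v)`, `v` inert -/

section CM

variable (L : Type) [Field L] [NumberField L] [IsCMField L] (v : HeightOneSpectrum (𝓞 ↥(maximalRealSubfield L)))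
  (w : PlacesOver L v) (hw : IsCMField.complexConj L • w.1 = w.1)
  (eA : Gqs L v ≃ₜ* ↥(unitaryGroupOfForm (galAdicCompletionMap (L := L) (IsCMField.complexConj L) hw) ((StdForm.antidiagonal 3).over (w.1.adicCompletion L))))
  (heA : ∀ g : Gqs L v,
    ((eA g : ↥(unitaryGroupOfForm (galAdicCompletionMap (L := L) (IsCMField.complexConj L) hw) ((StdForm.antidiagonal 3).over (w.1.adicCompletion L)))) : GL (Fin 3) (w.1.adicCompletion L)) =
      ((localNonsplitEquiv (IsCMField.complexConj L) (qsForm L) (IsCMField.complexConj_ne_one L) w hw g :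
        ↥(unitaryGroupOfForm (galAdicCompletionMap (L := L) (IsCMField.complexConj L) hw) (placeForm (qsForm L) w.1))) : GL (Fin 3) (w.1.adicCompletion L)))

include heA in
set_option maxHeartbeats 8000000 in
set_option synthInstance.maxHeartbeats 400000 in
-- statement∕proof-heavy: the `SmoothInd` carrier of `cmPrincipalSeries` and ★ N1's datum; the proof is §2 fed term-for-term (class of ★ p855058 §3, ★-filed II-3 §3)
/-- **IWAHORI CODETECTION (Borel's lemma, quotient direction) for the regular unramified principal series of `U(Φ₃)(L⁺_v)`, `v` inert**: for `χ = (χ₁, χ₂)` continuous, REGULAR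
(`χ ≠ wχ = (χ̄₁⁻¹, χ₂)`), with `χ` AND `wχ` trivial on `T ∩ K_v`, and a `G`-stable `N ≠ ⊤` of `V = i_G(χ)`: the Iwahori plane `V^I` is NOT contained in `N`.  ★ N1 gives the `wχ`-line of
`r_B V`; regularity gives `m₀`; for `m₁ ∈ T ∩ I ⊆ T ∩ K_v` (★ FILE C `mem_K0_iff_mem_integralLevel`) `χ(m₁) = wχ(m₁) = 1` and `δ_B^{1∕2}(m₁) = 1` (`I` compact); `T` is abelian (★
`torusU_mul_comm`); §2 with the datum ★-filed `exists_iwahoriDatum_K_zero_eq` (`K 0 = I`), ★ `isAdmissible_cmPrincipalSeries_of_iwasawa`, ★ `isLimitOfCompactOpen_cmBorelTriple_N` and «no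
constituent has `r = 0`» (★ N6).  With ★-filed II-3 (`N ∩ V^I ≠ 0`) this makes `N ∩ V^I` a LINE — the `hline` of ★ p855172. [cite: Borel1976, Lemma 4.7] [cite: Casselman1995, Thm. 3.3.3, L. 7.1.1]
[cite: Keys1984, §3, §7] -/
theorem not_fixedPoints_I_le (hns : ∀ w' : PlacesOver L v, IsCMField.complexConj L • w'.1 = w'.1) {ϖ : w.1.adicCompletion L}
    (hd : HermitianLattice.UnramifiedLocalConjDatum (galAdicCompletionMap (L := L) (IsCMField.complexConj L) hw) ϖ)
    (g₁ : GL (Fin 3) (w.1.adicCompletion L)) (hg₁ : (g₁ : Matrix (Fin 3) (Fin 3) (w.1.adicCompletion L)) = Matrix.diagonal ![(1 : w.1.adicCompletion L), 1, ϖ])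
    (K0 K1 I : Subgroup (Gqs L v))
    (hK0 : K0 = ((glInt 3 (w.1.adicCompletion L)).subgroupOf
      (unitaryGroupOfForm (galAdicCompletionMap (L := L) (IsCMField.complexConj L) hw) ((StdForm.antidiagonal 3).over (w.1.adicCompletion L)))).comap
        eA.toMulEquiv.toMonoidHom)
    (hK1 : K1 = (((glInt 3 (w.1.adicCompletion L)).map (MulAut.conj g₁).toMonoidHom).subgroupOf
      (unitaryGroupOfForm (galAdicCompletionMap (L := L) (IsCMField.complexConj L) hw) ((StdForm.antidiagonal 3).over (w.1.adicCompletion L)))).comap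
        eA.toMulEquiv.toMonoidHom)
    (hI : I = K0 ⊓ K1)
    (χ₁ : (LocalRing L v)ˣ →* ℂˣ) (χ₂ : ↥(normOneUnits (conjLocal L (IsCMField.complexConj L) v)) →* ℂˣ)
    (h₁ : Continuous fun x => ((χ₁ x : ℂˣ) : ℂ)) (h₂ : Continuous fun x => ((χ₂ x : ℂˣ) : ℂ))
    (hreg : cmTorusCharPair L v χ₁ χ₂ ≠ cmTorusCharPair L v (conjInvChar (conjLocal L (IsCMField.complexConj L) v) χ₁) χ₂)
    (hU : ∀ t : ↥(torusU (conjLocal L (IsCMField.complexConj L) v) (cmLocalForm L 3 v)),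
      (t : ↥(unitaryGroupOfForm (conjLocal L (IsCMField.complexConj L) v) (cmLocalForm L 3 v))) ∈ cmLocalIntegralLevel L 3 (qsForm L) v → cmTorusCharPair L v χ₁ χ₂ t = 1)
    (hUw : ∀ t : ↥(torusU (conjLocal L (IsCMField.complexConj L) v) (cmLocalForm L 3 v)),
      (t : ↥(unitaryGroupOfForm (conjLocal L (IsCMField.complexConj L) v) (cmLocalForm L 3 v))) ∈ cmLocalIntegralLevel L 3 (qsForm L) v →
        cmTorusCharPair L v (conjInvChar (conjLocal L (IsCMField.complexConj L) v) χ₁) χ₂ t = 1)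
    (N : Subrepresentation (cmPrincipalSeries L 3 v (cmTorusCharPair L v χ₁ χ₂))) (htop : N ≠ ⊤) :
    ¬ ((cmPrincipalSeries L 3 v (cmTorusCharPair L v χ₁ χ₂)).fixedPoints I ≤ N.toSubmodule) := by
  haveI := locallyCompactSpace_cmBorelU L 3 v
  -- the datum with `K 0 = I`
  obtain ⟨𝓘, h𝓘⟩ := exists_iwahoriDatum_K_zero_eq L v w hw eA heA hd g₁ hg₁ K0 K1 I hK0 hK1 hI
  -- ★ N1 (all three conjuncts), smoothness, admissibility
  obtain ⟨hfd, hX2, hJ⟩ := (UnitaryGroup.U3PrincipalSeriesJacquetFiltration_iff L).1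
    (F0P3U3PrincipalSeriesJacquetFiltrationHolds.U3PrincipalSeriesJacquetFiltration_holds L) v hns χ₁ χ₂ h₁ h₂
  have hsm : (cmPrincipalSeries L 3 v (cmTorusCharPair L v χ₁ χ₂)).IsSmooth := isSmooth_cmPrincipalSeries L v _
  have hadm := isAdmissible_cmPrincipalSeries_of_iwasawa L 3 v (exists_borel_mul_mem_cmLocalIntegralLevel L 3 v) (cmTorusCharPair L v χ₁ χ₂)
  have hlev := isOpen_isCompact_levels L v w hw eA g₁ K0 K1 I hK0 hK1 hI
  have hIc : IsCompact (I : Set (Gqs L v)) := hlev.2.2.2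
  -- a regular witness `m₀`
  obtain ⟨m₀, hm₀⟩ : ∃ m₀ : ↥(torusU (conjLocal L (IsCMField.complexConj L) v) (cmLocalForm L 3 v)),
      ((cmWeylTorusCharPair L v χ₁ χ₂ m₀ : ℂˣ) : ℂ) ≠ ((cmTorusCharPair L v χ₁ χ₂ m₀ : ℂˣ) : ℂ) := by
    by_contra hall
    push Not at hall
    exact hreg (MonoidHom.ext fun m => (Units.ext (hall m)).symm)
  -- `m₁ ∈ T ∩ I` lies in `K_v`
  have hKv : ∀ m₁ : ↥(torusU (conjLocal L (IsCMField.complexConj L) v) (cmLocalForm L 3 v)),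
      (m₁ : ↥(unitaryGroupOfForm (conjLocal L (IsCMField.complexConj L) v) (cmLocalForm L 3 v))) ∈ I →
      (m₁ : ↥(unitaryGroupOfForm (conjLocal L (IsCMField.complexConj L) v) (cmLocalForm L 3 v))) ∈ cmLocalIntegralLevel L 3 (qsForm L) v :=
    fun m₁ hm₁ => (mem_K0_iff_mem_integralLevel L v w hw eA heA K0 hK0 _).1 (I_le_K0 L v K0 K1 I hI hm₁)
  -- `T ∩ I` fixes the normalised, hence the unnormalised, Jacquet module
  have hnorm := fun (m₁ : ↥(torusU (conjLocal L (IsCMField.complexConj L) v) (cmLocalForm L 3 v)))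
      (hm₁ : (m₁ : ↥(unitaryGroupOfForm (conjLocal L (IsCMField.complexConj L) v) (cmLocalForm L 3 v))) ∈ I) =>
    normalizedJacquet_apply_eq_self_of_lineDatum (cmBorelTriple L 3 v) (cmPrincipalSeries L 3 v (cmTorusCharPair L v χ₁ χ₂))
      (cmTorusCharPair L v χ₁ χ₂) (cmWeylTorusCharPair L v χ₁ χ₂) hJ m₀ hm₀ m₁ (hU m₁ (hKv m₁ hm₁)) (hUw m₁ (hKv m₁ hm₁))
      (torusU_mul_comm (conjLocal L (IsCMField.complexConj L) v) (cmLocalForm L 3 v) m₀ m₁)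
  have hfix := jacquetModule_apply_eq_self_of_normalizedJacquet_eq_self (cmBorelTriple L 3 v) (cmPrincipalSeries L 3 v (cmTorusCharPair L v χ₁ χ₂)) I
    hnorm (fun m hm => rootDeltaChar_borel_eq_one_of_mem_isCompact _ _ (cmLocalForm_eq_over L 3 v) hIc _ hm)
  -- §2
  have key := not_fixedPoints_le_of_jacquet_trivial (cmBorelTriple L 3 v) 𝓘 (cmPrincipalSeries L 3 v (cmTorusCharPair L v χ₁ χ₂)) hadm hsm
    (isLimitOfCompactOpen_cmBorelTriple_N L 3 v)
    (fun c hc => by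
      obtain ⟨r, rfl⟩ := IrrClass.mk_surjective c
      exact ⟨r, rfl, not_subsingleton_iff_nontrivial.mp fun h0 =>
        not_subsingleton_coinvariants_of_isConstituentOf_cmPrincipalSeries L v u3_isSupercuspidal_iff_jacquet_eq_zero_holds hns _ r hc h0⟩)
    (fun m hm => hfix m (h𝓘 ▸ hm)) N htop
  rw [h𝓘] at key
  exact key

end CM

end Summit.HodgeConjecture.HodgeConjecture.Cruxes.H413.K2E3IwahoriCodetection

end
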